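import Summits.Ventures.WeilGRH.ReflectionInequality
import HarnessLib

/-!
# GRH arm (rh-explicit, venture WeilGRH): the REFLECTION transfer through the prime `2`

On a window `[-a, a]` with `log 2 < 2a ≤ log 3` exactly one prime power, `n = 2`, enters the
explicit formula of `k = g ⋆ g̃`, and (comparing Weil's functional for a character `χ` mod
`q ≠ 1` with the one for `ζ`, as in `OnePrimeTransfer`)

`Re Q_χ(g) ≥ Re Q_ζ(g) − 2 Re(ĝ(0) conj ĝ(1)) + (log q)‖g‖₂² + √2·log 2 · Re[(1 − χ(2)) k(log 2)]`.

`OnePrimeTransfer` bounds the two corrections separately by Cauchy–Schwarz (`q ≥ 81` at the rung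
`(log 3)/2`). Here they are bounded JOINTLY. Write `L = log 2`, `m = L − a ∈ (0, a)`,
`c = ∫ g(x) cosh(x/2) dx` (so that `2 Re(ĝ(0)conj ĝ(1)) = 2|c|² − 2|s|² ≤ 2|c|²`), and note
`k(L) = ∫_m^a g(x) conj g(x − L) dx` (support). With a unit complex number `ω` and
`Ψ_± = ω g(x) ± g(x − L)` on `[m, a]` one has the pointwise identities
`|Ψ₊|² + |Ψ₋|² = 2(|g(x)|² + |g(x−L)|²)`, `|Ψ₊|² − |Ψ₋|² = 4 Re(ω g(x) conj g(x−L))`, and,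
after folding `[-a, -m]` onto `[m, a]` by `x ↦ −x` and then reflecting by `x ↦ L − x`,
`c = ∫_{-m}^{m} g cosh(x/2) + ½ ∫_m^a (Ψ₊ η₊ + Ψ₋ η₋)`, `η_± = conj(ω) cosh(x/2) ± cosh((L−x)/2)`.
The weighted inequality `2|uv| ≤ μ|u|² + |v|²/μ` with weights `λB`, `λ(B ± κ)` and optimisation in
`λ` give the **reflection inequality**

`|c|² ≤ G · (B‖g‖₂² + 2κ Re(ω k(L)))`,
`G = C_M/B + (C_A + Re ω · I_A)/(B + κ) + (C_A − Re ω · I_A)/(B − κ)`,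

with the closed forms `C_M = ∫_{-m}^{m} cosh²(x/2) = sinh m + m`,
`C_A = ∫_m^a cosh²(x/2) = (sinh a − sinh m + a − m)/2`,
`I_A = ∫_m^a cosh(x/2)cosh((L−x)/2) = (a − m)cosh(L/2)/2 + sinh(a − L/2)`.
Taking `1 − χ(2) = ‖1 − χ(2)‖·ω`, `κ = (log 2/√2)‖1 − χ(2)‖`, `B ≤ log q` and `2G ≤ 1` yields the
**reflection transfer**: Weil positivity for `ζ` on `[-a, a]` implies `WeilPositivityOnChar χ a`.

At the `ζ` ladder's base rung `a = (log 3)/2` (Yoshida; kernel-checked in the tree) this proves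
`WeilPositivityOnChar χ ((log 3)/2)` for EVERY Dirichlet character of EVERY modulus `q ≥ 10`
(`OnePrimeTransfer`: `q ≥ 81`), for every character of even modulus `q ≥ 8`, and for the characters
mod `7` and `9` with `χ(2)` a nontrivial cube resp. sixth root of unity; at the rung `2/5` it proves the
rung for every character mod `q ≥ 6` and for the characters mod `5` with `χ(2) ≠ 1`.

No spectral theory and no numerics beyond rational bounds on `log 2, log 3, log 5, √2, √3, e^{2/5}`:
interval splitting, two changes of variables, the parallelogram law and one weighted AM–GM.

## References

* A. Weil (1952), (11) and the «lemme» p. 262; H. Yoshida (1992), Thm 1 (the rung `(log 3)/2`).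
-/

noncomputable section

open Complex Filter Set MeasureTheory
open scoped Real Topology ComplexConjugate ArithmeticFunction.vonMangoldt

namespace Summit.Ventures.WeilGRH

open Literature.NumberTheory.LFunctions

variable {g : ℝ → ℂ}

/-! ## The three corrections: bookkeeping -/

variable {q : ℕ}

/-- **`Q_χ` versus `Q_ζ`** (support-free bookkeeping, any parity, `q ≠ 1`):
`Re Q_χ(g) ≥ Re Q_ζ(g) − 2Re(ĝ(0)conj ĝ(1)) + (log q)‖g‖₂² + Re[P_ζ(k) − P_χ(k)]`, `k = g ⋆ g̃`
(equality for even `χ`; for odd `χ` the parity term `(1/2π)(A₁ − A₀) ≥ 0` is dropped,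
`arch_integral_par_zero_le_one`). [cite: Weil1952FormulesExplicites, (11) pp. 261–262] -/
theorem re_weilQuadraticChar_ge [NeZero q] (hq1 : q ≠ 1) (χ : DirichletCharacter ℂ q)
    (hg : IsWeilTest g) :
    (weilQuadratic g).re - 2 * (weilMellin g 0 * conj (weilMellin g 1)).re +
        (∫ t, ‖g t‖ ^ 2) * Real.log q +
        (weilPrimeTerm (weilConv g (weilReflect g)) -
          weilPrimeTermChar χ (weilConv g (weilReflect g))).re ≤
      (weilQuadraticChar χ g).re := by
  set k := weilConv g (weilReflect g) with hk
  set N : ℝ := ∫ t : ℝ, ‖g t‖ ^ 2 with hN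
  set P : ℝ := 2 * (weilMellin g 0 * conj (weilMellin g 1)).re with hP
  set D : ℂ := weilPrimeTerm k - weilPrimeTermChar χ k with hD
  set A0 : ℝ := ∫ t : ℝ, ‖weilMellin g (1 / 2 + t * I)‖ ^ 2 *
    (Complex.digamma (1 / 4 + ((0 : ℕ) : ℂ) / 2 + t / 2 * I)).re with hA0
  set A1 : ℝ := ∫ t : ℝ, ‖weilMellin g (1 / 2 + t * I)‖ ^ 2 *
    (Complex.digamma (1 / 4 + ((1 : ℕ) : ℂ) / 2 + t / 2 * I)).re with hA1
  have hI0 : weilArchIntegral k = (A0 : ℂ) := by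
    rw [← weilArchIntegralChar_zero, hk, weilArchIntegralChar_weilConv_weilReflect hg 0]
  have hI1 : weilArchIntegralChar 1 k = (A1 : ℂ) := by
    rw [hk, weilArchIntegralChar_weilConv_weilReflect hg 1]
  have hA : A0 ≤ A1 := arch_integral_par_zero_le_one hg
  have hπ0 : 0 ≤ 1 / (2 * π) := by positivity
  have hπ : ((1 / (2 * π) : ℂ)) = ((1 / (2 * π) : ℝ) : ℂ) := by push_cast; ring
  rcases χ.even_or_odd with hχ | hχ
  · have hQ : weilQuadraticChar χ g =
        weilQuadratic g - weilPolarTerm k + k 0 * (Real.log q : ℂ) + D := by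
      show weilFunctionalChar χ k = weilFunctional k - weilPolarTerm k + k 0 * (Real.log q : ℂ) + D
      rw [hD]
      unfold weilFunctionalChar weilFunctional weilArchTermChar weilArchTerm
      rw [if_neg hq1, charParity_of_even hχ, weilArchIntegralChar_zero]
      push_cast
      ring
    have hre : (weilQuadraticChar χ g).re = (weilQuadratic g).re - P + N * Real.log q + D.re := by
      rw [hQ, hk, weilPolarTerm_weilConv_weilReflect hg, weilConv_weilReflect_apply_zero, hP, hN]
      simp only [sub_re, add_re, Complex.ofReal_re, mul_re, Complex.ofReal_im, mul_zero,
        sub_zero]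
    rw [hre]
  · have hQ : weilQuadraticChar χ g =
        weilQuadratic g - weilPolarTerm k + k 0 * (Real.log q : ℂ) + D +
          (1 / (2 * π) : ℂ) * ((A1 : ℂ) - (A0 : ℂ)) := by
      show weilFunctionalChar χ k = weilFunctional k - weilPolarTerm k + k 0 * (Real.log q : ℂ) +
          D + (1 / (2 * π) : ℂ) * ((A1 : ℂ) - (A0 : ℂ))
      rw [hD]
      unfold weilFunctionalChar weilFunctional weilArchTermChar weilArchTerm
      rw [if_neg hq1, charParity_of_odd hχ, hI1, hI0]
      push_cast
      ring
    have hre : (weilQuadraticChar χ g).re =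
        (weilQuadratic g).re - P + N * Real.log q + D.re + 1 / (2 * π) * (A1 - A0) := by
      rw [hQ, hπ, hk, weilPolarTerm_weilConv_weilReflect hg, weilConv_weilReflect_apply_zero, hP, hN]
      simp only [sub_re, add_re, Complex.ofReal_re, mul_re, Complex.ofReal_im, mul_zero,
        sub_zero, zero_mul]
    rw [hre]
    nlinarith [mul_nonneg hπ0 (sub_nonneg.2 hA)]

/-- **The polar term is at most `2|c|²`**, `c = ∫ g(x) cosh(x/2) dx`: with
`s = ∫ g(x) sinh(x/2) dx` one has `ĝ(1) = c + s`, `ĝ(0) = c − s` and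
`2 Re(ĝ(0) conj ĝ(1)) = 2|c|² − 2|s|²`. [cite: Yoshida1992, §6 eq. (6.2)] -/
theorem two_mul_re_weilMellin_le (hg : IsWeilTest g) :
    2 * (weilMellin g 0 * conj (weilMellin g 1)).re ≤
      2 * ‖∫ x, g x * (Real.cosh (x / 2) : ℂ)‖ ^ 2 := by
  have hgi : ∀ φ : ℝ → ℝ, Continuous φ → Integrable fun x ↦ g x * (φ x : ℂ) := fun φ hφ ↦
    (hg.1.continuous.mul (continuous_ofReal.comp hφ)).integrable_of_hasCompactSupport
      hg.2.mul_right
  set c : ℂ := ∫ x : ℝ, g x * (Real.cosh (x / 2) : ℂ) with hc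
  set s : ℂ := ∫ x : ℝ, g x * (Real.sinh (x / 2) : ℂ) with hs
  have h1 : weilMellin g 1 = c + s := by
    unfold weilMellin
    rw [hc, hs, ← integral_add (hgi _ (by fun_prop)) (hgi _ (by fun_prop))]
    congr 1 with x
    have : cexp ((1 - 1 / 2) * (x : ℂ)) = (Real.cosh (x / 2) : ℂ) + (Real.sinh (x / 2) : ℂ) := by
      rw [← Complex.ofReal_add, Real.cosh_add_sinh, Complex.ofReal_exp]
      congr 1
      push_cast
      ring
    rw [this]
    ring
  have h0 : weilMellin g 0 = c - s := by
    unfold weilMellin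
    rw [hc, hs, ← integral_sub (hgi _ (by fun_prop)) (hgi _ (by fun_prop))]
    congr 1 with x
    have : cexp ((0 - 1 / 2) * (x : ℂ)) = (Real.cosh (x / 2) : ℂ) - (Real.sinh (x / 2) : ℂ) := by
      rw [← Complex.ofReal_sub, Real.cosh_sub_sinh, Complex.ofReal_exp]
      congr 1
      push_cast
      ring
    rw [this]
    ring
  have hre : (weilMellin g 0 * conj (weilMellin g 1)).re = ‖c‖ ^ 2 - ‖s‖ ^ 2 := by
    rw [h0, h1, ← Complex.normSq_eq_norm_sq, ← Complex.normSq_eq_norm_sq, Complex.normSq_apply,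
      Complex.normSq_apply]
    simp only [mul_re, sub_re, sub_im, map_add, add_re, add_im, conj_re, conj_im]
    ring
  rw [hre]
  nlinarith [sq_nonneg ‖s‖]

/-- **The one-prime correction through the reflection identity**: on the window `[-log 3, log 3]`,
`Re[P_ζ(k) − P_χ(k)] = 2 (log 2/√2) · Re[(1 − χ(2)) k(log 2)]` (`k(−log 2) = conj k(log 2)`,
`Λ(2) = log 2`). [cite: Weil1952FormulesExplicites, (11) pp. 261–262, prime term] -/
theorem re_weilPrimeTerm_sub_weilPrimeTermChar (χ : DirichletCharacter ℂ q) (hg : IsWeilTest g)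
    (h : tsupport (weilConv g (weilReflect g)) ⊆ Icc (-Real.log 3) (Real.log 3)) :
    (weilPrimeTerm (weilConv g (weilReflect g)) - weilPrimeTermChar χ (weilConv g (weilReflect g))).re =
      2 * (Real.log 2 / Real.sqrt 2) *
        ((1 - χ (2 : ZMod q)) * weilConv g (weilReflect g) (Real.log 2)).re := by
  set k := weilConv g (weilReflect g) with hk
  have hkc : Continuous k := (hg.weilConv hg.weilReflect).1.continuous
  rw [weilPrimeTerm_sub_weilPrimeTermChar χ hkc h]
  have h2 : ((2 : ℕ) : ZMod q) = 2 := by norm_cast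
  have hl2 : Real.log ((2 : ℕ) : ℝ) = Real.log 2 := by norm_num
  have hneg : k (-Real.log 2) = conj (k (Real.log 2)) := by
    rw [hk, ← conj_weilConv_weilReflect_neg g (Real.log 2), Complex.conj_conj]
  have hΛ : ((Λ 2 : ℝ) : ℂ) / (Real.sqrt (2 : ℕ) : ℂ) = ((Real.log 2 / Real.sqrt 2 : ℝ) : ℂ) := by
    rw [ArithmeticFunction.vonMangoldt_apply_prime Nat.prime_two]
    push_cast
    ring
  rw [h2, hl2, hneg, hΛ]
  set z : ℂ := (1 - χ (2 : ZMod q)) * k (Real.log 2) with hz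
  have hsum : (1 - χ (2 : ZMod q)) * k (Real.log 2) +
      (1 - conj (χ (2 : ZMod q))) * conj (k (Real.log 2)) = ((2 * z.re : ℝ) : ℂ) := by
    have : (1 - conj (χ (2 : ZMod q))) * conj (k (Real.log 2)) = conj z := by
      rw [hz, map_mul, map_sub, map_one]
    rw [this, Complex.add_conj, Complex.ofReal_mul, Complex.ofReal_ofNat]
  rw [hsum, ← Complex.ofReal_mul, Complex.ofReal_re]
  ring

/-! ## The reflection transfer -/

set_option maxHeartbeats 400000 in
/-- **REFLECTION TRANSFER (any parity, any `χ(2)`).** Let `log 2 < 2a ≤ log 3`, `q ≠ 1`, `χ` a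
Dirichlet character mod `q`, `u = 1 − χ(2)`, `k' = log 2/√2`, `κ = k'‖u‖`, `0 < B ≤ log q` with
`κ < B`, and `m, C_M, C_A, I_A` the closed forms of `reflection_inequality`. If Weil positivity for
`ζ` holds on `[-a, a]` and the **reflection criterion**

`2·[C_M (B² − κ²) + 2B (B·C_A − k'·Re(u)·I_A)] ≤ B (B² − κ²)`

holds (this is `2G ≤ 1` for `G = C_M/B + (C_A + Re ω I_A)/(B+κ) + (C_A − Re ω I_A)/(B−κ)`,
`u = ‖u‖ω`, cleared of denominators), then `WeilPositivityOnChar χ a`.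
[cite: Weil1952FormulesExplicites, (11) and the «lemme» p. 262; Yoshida1992, Thm 1] -/
theorem weilPositivityOnChar_transfer_reflection [NeZero q] {a : ℝ} (ha1 : Real.log 2 < 2 * a)
    (ha3 : 2 * a ≤ Real.log 3) (hζ : WeilPositivityOn a) (hq1 : q ≠ 1)
    (χ : DirichletCharacter ℂ q) {B κ : ℝ} (hBq : B ≤ Real.log q)
    (hκ : κ = Real.log 2 / Real.sqrt 2 * ‖1 - χ (2 : ZMod q)‖) (hκB : κ < B)
    {m CM CA IA : ℝ} (hm : m = Real.log 2 - a) (hCM : CM = Real.sinh m + m)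
    (hCA : CA = (Real.sinh a - Real.sinh m + (a - m)) / 2)
    (hIA : IA = (a - m) * Real.cosh (Real.log 2 / 2) / 2 + Real.sinh (a - Real.log 2 / 2))
    (hcrit : 2 * (CM * (B ^ 2 - κ ^ 2) +
        2 * B * (B * CA - Real.log 2 / Real.sqrt 2 * (1 - χ (2 : ZMod q)).re * IA)) ≤
      B * (B ^ 2 - κ ^ 2)) :
    WeilPositivityOnChar χ a := by
  intro g hg hsupp
  set L := Real.log 2 with hL
  set k' : ℝ := Real.log 2 / Real.sqrt 2 with hk'
  set u : ℂ := 1 - χ (2 : ZMod q) with hu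
  set r : ℝ := ‖u‖ with hr
  have hk'0 : 0 < k' := div_pos (Real.log_pos (by norm_num)) (by positivity)
  have hr0 : 0 ≤ r := norm_nonneg _
  have hκ0 : 0 ≤ κ := by rw [hκ]; exact mul_nonneg hk'0.le hr0
  have hB : 0 < B := lt_of_le_of_lt hκ0 hκB
  have ha2 : a < Real.log 2 := by
    have h3 : Real.log 3 < 2 * Real.log 2 := by
      rw [← Real.log_rpow (by norm_num), show ((2 : ℝ) ^ (2 : ℝ)) = 4 by norm_num]
      exact Real.log_lt_log (by norm_num) (by norm_num)
    linarith
  -- the phase `ω` of `u`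
  obtain ⟨ω, hω, huω⟩ : ∃ ω : ℂ, ‖ω‖ = 1 ∧ u = (r : ℂ) * ω := by
    by_cases hu0 : u = 0
    · exact ⟨1, by simp, by simp [hr, hu0]⟩
    · have hr' : r ≠ 0 := by rw [hr]; exact norm_ne_zero_iff.2 hu0
      refine ⟨u / (r : ℂ), ?_, ?_⟩
      · rw [norm_div, Complex.norm_real, Real.norm_eq_abs, abs_of_nonneg hr0, hr, div_self]
        exact norm_ne_zero_iff.2 hu0
      · rw [mul_div_cancel₀ _ (by exact_mod_cast hr')]
  have hωre : (r : ℝ) * ω.re = u.re := by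
    rw [huω, Complex.re_ofReal_mul]
  -- the reflection inequality for this `ω`
  set kL := weilConv g (weilReflect g) L with hkL
  set N : ℝ := ∫ x, ‖g x‖ ^ 2 with hN
  set c : ℂ := ∫ x, g x * (Real.cosh (x / 2) : ℂ) with hc
  obtain ⟨hW0, hineq⟩ := reflection_inequality hg hsupp ha1 ha2 hω hκ0 hκB hm hCM hCA hIA
  set W : ℝ := B * N + 2 * κ * (ω * kL).re with hW
  set G : ℝ := CM / B + (CA + ω.re * IA) / (B + κ) + (CA - ω.re * IA) / (B - κ) with hG
  have hBp : 0 < B + κ := by linarith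
  have hBm : 0 < B - κ := by linarith
  -- `2G ≤ 1` from the cleared criterion
  have hκre : κ * ω.re = k' * u.re := by
    rw [hκ, ← hωre, hk', hr]; ring
  have hGB : G * (B * ((B + κ) * (B - κ))) =
      CM * (B ^ 2 - κ ^ 2) + 2 * B * (B * CA - k' * u.re * IA) := by
    rw [hG, ← hκre]
    field_simp
    ring
  have h2G : 2 * G ≤ 1 := by
    have hpos : 0 < B * ((B + κ) * (B - κ)) := by positivity
    refine le_of_mul_le_mul_right ?_ hpos
    calc 2 * G * (B * ((B + κ) * (B - κ))) = 2 * (G * (B * ((B + κ) * (B - κ)))) := by ring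
      _ = 2 * (CM * (B ^ 2 - κ ^ 2) + 2 * B * (B * CA - k' * u.re * IA)) := by rw [hGB]
      _ ≤ B * (B ^ 2 - κ ^ 2) := hcrit
      _ = 1 * (B * ((B + κ) * (B - κ))) := by ring
  have hc2 : 2 * ‖c‖ ^ 2 ≤ W := by
    have : ‖c‖ ^ 2 ≤ W * G := hineq
    nlinarith
  -- the corrections
  have hk : tsupport (weilConv g (weilReflect g)) ⊆ Icc (-Real.log 3) (Real.log 3) :=
    (tsupport_weilConv_weilReflect_subset hg.2 hsupp).trans (Icc_subset_Icc (by linarith) ha3)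
  have hD := re_weilPrimeTerm_sub_weilPrimeTermChar χ hg hk
  have hDW : 2 * κ * (ω * kL).re = 2 * k' * (u * kL).re := by
    rw [huω, mul_assoc (r : ℂ), Complex.re_ofReal_mul, hκ, hk', hr]
    ring
  have hmain := re_weilQuadraticChar_ge hq1 χ hg
  have hζg : 0 ≤ (weilQuadratic g).re := hζ g hg hsupp
  have hP := two_mul_re_weilMellin_le hg
  have hN0 : 0 ≤ N := integral_nonneg fun t ↦ by positivity
  have hNB : B * N ≤ N * Real.log q := by nlinarith
  rw [hD] at hmain
  rw [hW, hDW] at hc2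
  linarith

end Summit.Ventures.WeilGRH
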